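import Summits.Ventures.PercRepro.ProfilePointedCircuitClassesStarSharpDefectA
import Summits.Ventures.PercRepro.ProfilePointedCircuitClassesStarSharpLoopD1

/-!
# PercRepro — THE ALL-ON CORE OF `StarNineSharp` DEFECT COUNT PART B: THE EXCLUDED PATTERNS ON `d0DON`
(p5, gen 55; `proofs/P5-GM1.md` §82 ADD 2 (f))

The two excluded three-defect patterns of parts D / D1, packaged on the demands of `d0DON`:
* `not_triangle_bad_of_P`: defects `{c, u}`, `{c, v}`, `{u, v}` with `v ∉ C`;
* `not_path_bad_of_P`: defects `{c, u}`, `{c, v}`, `{u, w}` with `v, w ∉ C` (`v ≠ w`).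
-/

open scoped Matroid

namespace PercRepro.Cogirth

open Finset ThmH Skew Shadow Profile

open Classical

variable {α : Type} [DecidableEq α] {N : Matroid α} [N.Finite]

section StarSharpDefectB

variable {b b' : α}


/-- **THE TRIANGLE PATTERN ON `d0DON`**: defects `{c, u}`, `{c, v}`, `{u, v}` with `v ∉ C` are impossible. -/
theorem not_triangle_bad_of_P (hn : (gr N).card = 9) (h : SeriesPair N b b')
    {e f : α} (he : e ∈ gr N) (hf : f ∈ gr N) (hef : e ≠ f) (heb : e ≠ b) (heb' : e ≠ b') (hfb : f ≠ b) (hfb' : f ≠ b')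
    (he1 : ∀ y ∈ ((((gr N).erase b).erase b').erase f).erase e, rk N {e, y} = 2)
    (hf1 : ∀ y ∈ ((((gr N).erase b).erase b').erase f).erase e, rk N {f, y} = 2)
    (hfc : ∀ y ∈ ((((gr N).erase b).erase b').erase f).erase e, rk N (((((gr N).erase b).erase b').erase f).erase y) = 4)
    (hX : rk N (((((gr N).erase b).erase b').erase f).erase e) = 4) (hef2 : rk N {e, f} = 2)
    {P : Finset α → Prop} [DecidablePred P]
    (hP : ∀ W ∈ (d0DON N b' e f).filter P, ¬ (rk N (insert f ((W.erase b).erase e)) = 3 ∧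
      rk N (insert e (((((gr N).erase b).erase b').erase f).erase e \ (W.erase b).erase e)) = 4))
    {W₁ W₂ W₃ : Finset α} (hW₁ : W₁ ∈ (d0DON N b' e f).filter P)
    (hW₂ : W₂ ∈ (d0DON N b' e f).filter P)
    (hW₃ : W₃ ∈ (d0DON N b' e f).filter P)
    {c u v : α} (hπ₁ : (W₁.erase b).erase e = {c, u}) (hπ₂ : (W₂.erase b).erase e = {c, v})
    (hπ₃ : (W₃.erase b).erase e = {u, v}) (hcu : c ≠ u) (hcv : c ≠ v) (huv : u ≠ v)
    (hv : ¬ (rk N {e, f, v} = 3 ∧ rk N ((((((gr N).erase b).erase b').erase f).erase e).erase v) = 4)) : False := by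
  have hb : b ∈ gr N := h.1
  have hb' : b' ∈ gr N := h.2.1
  have hbb' : b ≠ b' := h.2.2.1
  have heE : e ∈ ((gr N).erase b).erase b' := mem_erase.2 ⟨heb', mem_erase.2 ⟨heb, he⟩⟩
  have hfE : f ∈ ((gr N).erase b).erase b' := mem_erase.2 ⟨hfb', mem_erase.2 ⟨hfb, hf⟩⟩
  have hX5 : (((((gr N).erase b).erase b').erase f).erase e).card = 5 := by
    rw [card_erase_of_mem (mem_erase.2 ⟨hef, heE⟩), card_erase_of_mem hfE,
      card_erase_of_mem (mem_erase.2 ⟨hbb'.symm, hb'⟩), card_erase_of_mem hb, hn]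
  have hbadC := defect_data_of_P hn h he hf hef heb heb' hfb hfb' he1 hf1 hX hef2 hP
  obtain ⟨hπX₁, -, -, hY₁, hYc₁, hres₁, -⟩ := hbadC W₁ hW₁
  obtain ⟨hπX₂, -, -, hY₂, hYc₂, hres₂, -⟩ := hbadC W₂ hW₂
  obtain ⟨hπX₃, -, -, hY₃, hYc₃, hres₃, -⟩ := hbadC W₃ hW₃
  rw [hπ₁] at hπX₁ hY₁ hYc₁ hres₁
  rw [hπ₂] at hπX₂ hY₂ hYc₂ hres₂
  rw [hπ₃] at hπX₃ hY₃ hYc₃ hres₃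
  have hcX : c ∈ ((((gr N).erase b).erase b').erase f).erase e := hπX₁ (mem_insert_self _ _)
  have huX : u ∈ ((((gr N).erase b).erase b').erase f).erase e := hπX₁ (mem_insert_of_mem (mem_singleton_self _))
  have hvX : v ∈ ((((gr N).erase b).erase b').erase f).erase e := hπX₂ (mem_insert_of_mem (mem_singleton_self _))
  have hrest : (((((gr N).erase b).erase b').erase f).erase e \ {c, u, v}).card = 2 := by
    rw [card_sdiff_of_subset (by
      intro a ha; simp only [mem_insert, mem_singleton] at ha
      rcases ha with rfl | rfl | rfl <;> assumption), hX5]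
    rw [card_insert_of_notMem, card_pair huv]
    simp only [mem_insert, mem_singleton, not_or]; exact ⟨hcu, hcv⟩
  obtain ⟨p, q, hpq, hrest_eq⟩ := card_eq_two.1 hrest
  have hpR : p ∈ ((((gr N).erase b).erase b').erase f).erase e \ {c, u, v} := by
    rw [hrest_eq]; exact mem_insert_self _ _
  have hqR : q ∈ ((((gr N).erase b).erase b').erase f).erase e \ {c, u, v} := by
    rw [hrest_eq]; exact mem_insert_of_mem (mem_singleton_self _)
  have hp3 := (mem_sdiff.1 hpR).2
  have hq3 := (mem_sdiff.1 hqR).2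
  simp only [mem_insert, mem_singleton, not_or] at hp3 hq3
  have hXeq : ((((gr N).erase b).erase b').erase f).erase e = {c, u, v, p, q} := by
    ext a
    constructor
    · intro ha
      by_cases ha3 : a ∈ ({c, u, v} : Finset α)
      · simp only [mem_insert, mem_singleton] at ha3
        rcases ha3 with rfl | rfl | rfl
        · exact mem_insert_self _ _
        · exact mem_insert_of_mem (mem_insert_self _ _)
        · exact mem_insert_of_mem (mem_insert_of_mem (mem_insert_self _ _))
      · have : a ∈ ((((gr N).erase b).erase b').erase f).erase e \ {c, u, v} := mem_sdiff.2 ⟨ha, ha3⟩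
        rw [hrest_eq] at this
        simp only [mem_insert, mem_singleton] at this
        rcases this with rfl | rfl
        · exact mem_insert_of_mem (mem_insert_of_mem (mem_insert_of_mem (mem_insert_self _ _)))
        · exact mem_insert_of_mem (mem_insert_of_mem (mem_insert_of_mem (mem_insert_of_mem
            (mem_singleton_self _))))
    · intro ha
      simp only [mem_insert, mem_singleton] at ha
      rcases ha with rfl | rfl | rfl | rfl | rfl
      · exact hcX
      · exact huX
      · exact hvX
      · exact (mem_sdiff.1 hpR).1
      · exact (mem_sdiff.1 hqR).1
  have hsd1 : ((((gr N).erase b).erase b').erase f).erase e \ {c, u} = {v, p, q} := by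
    rw [hXeq]
    exact quint_sdiff_xy hcv (Ne.symm hp3.1) (Ne.symm hq3.1) huv (Ne.symm hp3.2.1) (Ne.symm hq3.2.1)
  have hsd2 : ((((gr N).erase b).erase b').erase f).erase e \ {c, v} = {u, p, q} := by
    rw [hXeq, quint_swap23]
    exact quint_sdiff_xy hcu (Ne.symm hp3.1) (Ne.symm hq3.1) huv.symm (Ne.symm hp3.2.2) (Ne.symm hq3.2.2)
  have hsd3 : ((((gr N).erase b).erase b').erase f).erase e \ {u, v} = {c, p, q} := by
    rw [hXeq]
    exact quint_sdiff_uv hcu hcv (Ne.symm hp3.2.1) (Ne.symm hq3.2.1) (Ne.symm hp3.2.2) (Ne.symm hq3.2.2)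
  rw [hsd1] at hYc₁ hres₁
  rw [hsd2] at hYc₂ hres₂
  rw [hsd3] at hYc₃ hres₃
  have hv' : ¬ (rk N {e, f, v} = 3 ∧ rk N {c, u, p, q} = 4) := by
    rw [← quint_erase_z hcv huv (Ne.symm hp3.2.2) (Ne.symm hq3.2.2), ← hXeq]; exact hv
  exact not_triangle_bad he hf hef heb heb' he1 hf1 hfc hX hef2 hcu hcv huv (Ne.symm hp3.2.2) (Ne.symm hq3.2.2) hvX
    hXeq hY₁ hYc₁ hY₂ hYc₂ hres₂ hY₃ hYc₃ hres₃ hv'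

/-- **THE PATH PATTERN ON `d0DON`**: defects `{c, u}`, `{c, v}`, `{u, w}` with `v ≠ w`, `v, w ∉ C` are impossible. -/
theorem not_path_bad_of_P (hn : (gr N).card = 9) (h : SeriesPair N b b')
    {e f : α} (he : e ∈ gr N) (hf : f ∈ gr N) (hef : e ≠ f) (heb : e ≠ b) (heb' : e ≠ b') (hfb : f ≠ b) (hfb' : f ≠ b')
    (he1 : ∀ y ∈ ((((gr N).erase b).erase b').erase f).erase e, rk N {e, y} = 2)
    (hf1 : ∀ y ∈ ((((gr N).erase b).erase b').erase f).erase e, rk N {f, y} = 2)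
    (hfc : ∀ y ∈ ((((gr N).erase b).erase b').erase f).erase e, rk N (((((gr N).erase b).erase b').erase f).erase y) = 4)
    (hX : rk N (((((gr N).erase b).erase b').erase f).erase e) = 4) (hef2 : rk N {e, f} = 2)
    {P : Finset α → Prop} [DecidablePred P]
    (hP : ∀ W ∈ (d0DON N b' e f).filter P, ¬ (rk N (insert f ((W.erase b).erase e)) = 3 ∧
      rk N (insert e (((((gr N).erase b).erase b').erase f).erase e \ (W.erase b).erase e)) = 4))
    {W₁ W₂ W₃ : Finset α} (hW₁ : W₁ ∈ (d0DON N b' e f).filter P)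
    (hW₂ : W₂ ∈ (d0DON N b' e f).filter P)
    (hW₃ : W₃ ∈ (d0DON N b' e f).filter P)
    {c u v w : α} (hπ₁ : (W₁.erase b).erase e = {c, u}) (hπ₂ : (W₂.erase b).erase e = {c, v})
    (hπ₃ : (W₃.erase b).erase e = {u, w}) (hcu : c ≠ u) (hcv : c ≠ v) (hcw : c ≠ w) (huv : u ≠ v) (huw : u ≠ w)
    (hvw : v ≠ w)
    (hv : ¬ (rk N {e, f, v} = 3 ∧ rk N ((((((gr N).erase b).erase b').erase f).erase e).erase v) = 4))
    (hw : ¬ (rk N {e, f, w} = 3 ∧ rk N ((((((gr N).erase b).erase b').erase f).erase e).erase w) = 4)) : False := by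
  have hb : b ∈ gr N := h.1
  have hb' : b' ∈ gr N := h.2.1
  have hbb' : b ≠ b' := h.2.2.1
  have heE : e ∈ ((gr N).erase b).erase b' := mem_erase.2 ⟨heb', mem_erase.2 ⟨heb, he⟩⟩
  have hfE : f ∈ ((gr N).erase b).erase b' := mem_erase.2 ⟨hfb', mem_erase.2 ⟨hfb, hf⟩⟩
  have hX5 : (((((gr N).erase b).erase b').erase f).erase e).card = 5 := by
    rw [card_erase_of_mem (mem_erase.2 ⟨hef, heE⟩), card_erase_of_mem hfE,
      card_erase_of_mem (mem_erase.2 ⟨hbb'.symm, hb'⟩), card_erase_of_mem hb, hn]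
  have hbadC := defect_data_of_P hn h he hf hef heb heb' hfb hfb' he1 hf1 hX hef2 hP
  obtain ⟨hπX₁, -, -, hY₁, hYc₁, hres₁, -⟩ := hbadC W₁ hW₁
  obtain ⟨hπX₂, -, -, hY₂, hYc₂, hres₂, -⟩ := hbadC W₂ hW₂
  obtain ⟨hπX₃, -, -, hY₃, hYc₃, hres₃, -⟩ := hbadC W₃ hW₃
  rw [hπ₁] at hπX₁ hY₁ hYc₁ hres₁
  rw [hπ₂] at hπX₂ hY₂ hYc₂ hres₂
  rw [hπ₃] at hπX₃ hY₃ hYc₃ hres₃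
  have hcX : c ∈ ((((gr N).erase b).erase b').erase f).erase e := hπX₁ (mem_insert_self _ _)
  have huX : u ∈ ((((gr N).erase b).erase b').erase f).erase e := hπX₁ (mem_insert_of_mem (mem_singleton_self _))
  have hvX : v ∈ ((((gr N).erase b).erase b').erase f).erase e := hπX₂ (mem_insert_of_mem (mem_singleton_self _))
  have hwX : w ∈ ((((gr N).erase b).erase b').erase f).erase e := hπX₃ (mem_insert_of_mem (mem_singleton_self _))
  have hrest : (((((gr N).erase b).erase b').erase f).erase e \ {c, u, v, w}).card = 1 := by
    rw [card_sdiff_of_subset (by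
      intro a ha; simp only [mem_insert, mem_singleton] at ha
      rcases ha with rfl | rfl | rfl | rfl <;> assumption), hX5]
    rw [card_insert_of_notMem, card_insert_of_notMem, card_pair hvw]
    · simp only [mem_insert, mem_singleton, not_or]; exact ⟨huv, huw⟩
    · simp only [mem_insert, mem_singleton, not_or]; exact ⟨hcu, hcv, hcw⟩
  obtain ⟨p, hrest_eq⟩ := card_eq_one.1 hrest
  have hpR : p ∈ ((((gr N).erase b).erase b').erase f).erase e \ {c, u, v, w} := by
    rw [hrest_eq]; exact mem_singleton_self _
  have hp4 := (mem_sdiff.1 hpR).2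
  simp only [mem_insert, mem_singleton, not_or] at hp4
  have hXeq : ((((gr N).erase b).erase b').erase f).erase e = {c, u, v, w, p} := by
    ext a
    constructor
    · intro ha
      by_cases ha4 : a ∈ ({c, u, v, w} : Finset α)
      · simp only [mem_insert, mem_singleton] at ha4
        rcases ha4 with rfl | rfl | rfl | rfl
        · exact mem_insert_self _ _
        · exact mem_insert_of_mem (mem_insert_self _ _)
        · exact mem_insert_of_mem (mem_insert_of_mem (mem_insert_self _ _))
        · exact mem_insert_of_mem (mem_insert_of_mem (mem_insert_of_mem (mem_insert_self _ _)))
      · have : a ∈ ((((gr N).erase b).erase b').erase f).erase e \ {c, u, v, w} := mem_sdiff.2 ⟨ha, ha4⟩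
        rw [hrest_eq] at this
        rw [mem_singleton.1 this]
        exact mem_insert_of_mem (mem_insert_of_mem (mem_insert_of_mem (mem_insert_of_mem (mem_singleton_self _))))
    · intro ha
      simp only [mem_insert, mem_singleton] at ha
      rcases ha with rfl | rfl | rfl | rfl | rfl
      · exact hcX
      · exact huX
      · exact hvX
      · exact hwX
      · exact (mem_sdiff.1 hpR).1
  have hsd1 : ((((gr N).erase b).erase b').erase f).erase e \ {c, u} = {v, w, p} := by
    rw [hXeq]
    exact quint_sdiff_xy hcv hcw (Ne.symm hp4.1) huv huw (Ne.symm hp4.2.1)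
  have hsd2 : ((((gr N).erase b).erase b').erase f).erase e \ {c, v} = {u, w, p} := by
    rw [hXeq, quint_swap23]
    exact quint_sdiff_xy hcu hcw (Ne.symm hp4.1) huv.symm hvw (Ne.symm hp4.2.2.1)
  have hsd3 : ((((gr N).erase b).erase b').erase f).erase e \ {u, w} = {c, v, p} := by
    rw [hXeq]
    exact quint_sdiff_uw hcu hcw huv (Ne.symm hp4.2.1) hvw (Ne.symm hp4.2.2.2)
  rw [hsd1] at hYc₁ hres₁
  rw [hsd2] at hYc₂ hres₂
  rw [hsd3] at hYc₃ hres₃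
  have hv' : ¬ (rk N {e, f, v} = 3 ∧ rk N {c, u, w, p} = 4) := by
    rw [← quint_erase_z hcv huv hvw (Ne.symm hp4.2.2.1), ← hXeq]; exact hv
  have hw' : ¬ (rk N {e, f, w} = 3 ∧ rk N {c, u, v, p} = 4) := by
    rw [← quint_erase_fourth hcw huw hvw (Ne.symm hp4.2.2.2), ← hXeq]; exact hw
  exact not_path_bad he hf hef heb heb' he1 hf1 hfc hX hef2 hcv huv hvw (Ne.symm hp4.2.2.1) huw hcw
    (Ne.symm hp4.2.2.2) hvX hwX hXeq hY₁ hYc₁ hY₂ hYc₂ hres₂ hY₃ hYc₃ hres₃ hv' hw'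

end StarSharpDefectB

end PercRepro.Cogirth
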